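import Literature.NumberTheory.GaloisRepresentations.ArtinConductorIntegralityProofs
import Literature.NumberTheory.GaloisRepresentations.HerbrandQuotientFormula
import HarnessLib

/-!
# Herbrand's theorem and the conductor formula `a_𝔓(ρ) = Σ (g_i/g_0) codim M^{G_i}`, unconditionally

`RamificationFiltration.lean` states Herbrand's theorem `(G/H)^v = G^v H/H` (Serre, *Local Fields*,
Ch. IV §3, Prop. 14) for a finite Galois extension `L/K` (`K = Frac R`, `R` Dedekind) and a normal
subextension `E` as the named fact `Literature.herbrand_quotient R E`;
`RamificationFiltrationTowerProofs.lean` and `ArtinConductorIntegrality(.Proofs).lean` reduce to it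
the surjectivity `Γ_K^u ↠ Gal(E/K)^u` (`absUpperRamificationSubgroup_map_absRestrictNormalHom`)
and the lower-numbering conductor formula `Literature.NumberTheory.GaloisRepresentations.GaloisRep.artinConductorAt_eq_finsum_ramificationSubgroup`
of `ArtinConductor.lean` (Serre, Ch. VI §2, Cor. 1').  With Serre's Prop. IV.3 proved for Galois
quotient data (`HerbrandQuotientFormula.lean`, `indexFormula_of_galoisQuotientData`) and
Herbrand's theorem derived from the index formula in `HerbrandTheorem.lean`
(`upperRamificationSubgroup_eq_map_restrictNormalHom_of_indexFormula`), this file discharges all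
three:

* `Literature.herbrand_quotient_holds R E : herbrand_quotient R E` — **Herbrand's theorem**, for every
  Dedekind `R` with fraction field `K`, finite Galois `L/K`, normal `E`, and maximal `𝔓` of
  `integralClosure R L` with separable residue extension (exactly the named fact's hypotheses):
  the data `(integralClosure R L, integralClosure R E, Gal(L/K), Gal(E/K), restriction, inclusion)`
  are Galois quotient data (`isGaloisGroup_ker`; invariants by the Galois correspondence,
  faithfulness by `faithfulSMul_algEquiv_integralClosure`), `integralClosure R L` is finite over
  `R₀ = R`, and `e(𝔓 | 𝔓 ∩ E) = #H_0` holds for separable residue extensions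
  (`emultiplicity_map_under_eq_card_inertia_of_isSeparable`);
* `Literature.NumberTheory.GaloisRepresentations.absUpperRamificationSubgroup_map_absRestrictNormalHom_holds` — by
  `absUpperRamificationSubgroup_map_absRestrictNormalHom_of`;
* `Literature.NumberTheory.GaloisRepresentations.GaloisRep.artinConductorAt_eq_finsum_ramificationSubgroup_holds` and
  `Literature.NumberTheory.GaloisRepresentations.GaloisRep.artinConductorAt_eq_artinExponent_inertia_holds` — by the reductions
  `…_of_herbrand_quotient` of `ArtinConductorIntegralityProofs.lean`.

## References

* J.-P. Serre, *Local Fields*, GTM 67, Springer 1979, Ch. IV §1 Prop. 3, §3 Prop. 14 and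
  Remark 1; Ch. VI §2, Cor. 1' to Prop. 2. [SerreLocalFields1979]
* N. M. Katz, *Gauss Sums, Kloosterman Sums, and Monodromy Groups*, Princeton 1988, Ch. 1,
  Prop. 1.9. [Katz1988]
-/

noncomputable section

open scoped NumberField
open Field IsDedekindDomain

namespace Literature.NumberTheory.GaloisRepresentations


/-! ### Discharge of `Literature.NumberTheory.GaloisRepresentations.herbrand_quotient` (Serre IV §3 Prop. 14 for a finite Galois `L/K`) -/

section HerbrandQuotientHolds

open scoped Pointwise

variable (R : Type*) {K L : Type*} [CommRing R] [Field K] [Field L] [Algebra R K] [Algebra R L]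
  [Algebra K L] [IsScalarTower R K L]

variable {R} in
/-- Galois quotient data give a Galois group in Mathlib's sense: for `ι : T → S` injective and
equivariant along `π : G → Q` with image the `ker π`-invariants, `ker π` is a Galois group for
`S` over `T` (`IsGaloisGroup`). [folklore] -/
theorem isGaloisGroup_ker {S T : Type*} [CommRing S] [CommRing T] {G Q : Type*} [Group G] [Group Q]
    [MulSemiringAction G S] [MulSemiringAction Q T] [FaithfulSMul G S] (π : G →* Q) (ι : T →+* S)
    (hequiv : ∀ (g : G) (t : T), ι (π g • t) = g • ι t)
    (hfix : ∀ a : S, (∀ h : π.ker, (h : G) • a = a) → a ∈ Set.range ι) :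
    letI : Algebra T S := ι.toAlgebra
    IsGaloisGroup π.ker T S := by
  letI : Algebra T S := ι.toAlgebra
  have halg : algebraMap T S = ι := rfl
  have hHfix : ∀ (h : π.ker) (a : T), (h : G) • ι a = ι a := fun h a => by
    rw [← hequiv, h.2, one_smul]
  exact
    { faithful := inferInstance
      commutes := ⟨fun h a b => by
        change (h : G) • (a • b) = a • (h : G) • b
        rw [Algebra.smul_def, Algebra.smul_def, smul_mul', halg, hHfix]⟩
      isInvariant := ⟨fun b hb => by
        obtain ⟨a, ha⟩ := hfix b fun h => hb h
        exact ⟨a, ha⟩⟩ }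

set_option synthInstance.maxHeartbeats 400000 in
set_option maxHeartbeats 1600000 in
/-- **Discharge of `Literature.NumberTheory.GaloisRepresentations.herbrand_quotient`: Herbrand's theorem `(G/H)^v = G^v H/H`** (Serre,
Ch. IV §3, Prop. 14) for a finite Galois extension `L/K`, `K = Frac R` with `R` Dedekind, a
normal subextension `E`, and a maximal ideal `𝔓` of `S_L = integralClosure R L` with separable
residue extension.  Proof: the Galois quotient data
`(S_L, S_E, Gal(L/K), Gal(E/K), restriction, inclusion)` satisfy the hypotheses of the core form
of Prop. IV.3 (`card_mul_lowerIndex_map_eq_finsum`, with `R₀ = R`: `S_L` is finite over `R`, the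
residue extension is separable by hypothesis, and `e(𝔓|𝔓 ∩ E) = #H_0` by
`emultiplicity_map_under_eq_card_inertia_of_isSeparable`), and Herbrand's theorem follows by
`upperRamificationSubgroup_eq_map_restrictNormalHom_of_indexFormula` (`HerbrandTheorem.lean`:
Serre's Lemmas IV.3.3–5, Prop. IV.15 and the surjectivity of inertia).  The invariants `S_L^{Gal(L/E)} = S_E` come from the Galois
correspondence (`IsGalois.fixedField_fixingSubgroup`), faithfulness of `Gal(L/K)` on `S_L` from
`K = Frac R`.
Ref: Serre, *Local Fields*, Ch. IV §3, Prop. 14 and Lemma 5; Ch. IV §1, Prop. 3.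
[cite: SerreLocalFields1979, Ch. IV §3 Prop. 14] -/
theorem herbrand_quotient_holds (E : IntermediateField K L) : herbrand_quotient R E := by
  intro _ _ _ _ _ 𝔓 _ hsep𝔓 v
  classical
  -- the data
  haveI : Algebra.IsSeparable K L := IsGalois.to_isSeparable
  haveI : IsDedekindDomain (integralClosure R L) := integralClosure.isDedekindDomain R K L
  haveI : IsDedekindDomain (integralClosure R E) := integralClosure.isDedekindDomain R K E
  haveI : FaithfulSMul (L ≃ₐ[K] L) (integralClosure R L) :=
    faithfulSMul_algEquiv_integralClosure R
  haveI : FaithfulSMul (E ≃ₐ[K] E) (integralClosure R E) :=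
    faithfulSMul_algEquiv_integralClosure R
  haveI : Module.Finite R (integralClosure R L) :=
    IsIntegralClosure.finite R K L (integralClosure R L)
  let π : (L ≃ₐ[K] L) →* (E ≃ₐ[K] E) := AlgEquiv.restrictNormalHom E
  let ι : integralClosure R E →+* integralClosure R L := (E.integralClosureInclusion R).toRingHom
  have hπ : Function.Surjective π := AlgEquiv.restrictNormalHom_surjective L
  have hι : Function.Injective ι := E.integralClosureInclusion_injective R
  have hequiv : ∀ (g : L ≃ₐ[K] L) (t : integralClosure R E), ι (π g • t) = g • ι t :=
    fun g t => E.integralClosureInclusion_restrictNormalHom_smul R g t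
  have hker : π.ker = E.fixingSubgroup := IntermediateField.restrictNormalHom_ker E
  have hfix : ∀ a : integralClosure R L, (∀ h : π.ker, (h : L ≃ₐ[K] L) • a = a) →
      a ∈ Set.range ι := by
    intro a ha
    have haE : (a : L) ∈ E := by
      rw [← IsGalois.fixedField_fixingSubgroup E, IntermediateField.mem_fixedField_iff]
      intro σ hσ
      have := congrArg (fun z : integralClosure R L => (z : L)) (ha ⟨σ, hker ▸ hσ⟩)
      simpa [integralClosure.coe_smul] using this
    have hint : IsIntegral R (⟨a, haE⟩ : E) :=
      (isIntegral_algHom_iff ((E.val).restrictScalars R) (fun x y h => Subtype.ext h)).mp a.2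
    exact ⟨⟨⟨a, haE⟩, hint⟩, Subtype.ext rfl⟩
  -- the hypotheses of the core form of Prop. IV.3, with `R₀ = R`
  have hsep : 𝔓 ≠ ⊥ → Algebra.IsSeparable (R ⧸ 𝔓.under R) (integralClosure R L ⧸ 𝔓) :=
    fun _ => hsep𝔓
  have hcard : 𝔓 ≠ ⊥ → emultiplicity 𝔓 ((𝔓.comap ι).map ι) = Nat.card (𝔓.inertia π.ker) := by
    intro h𝔓
    letI algTS : Algebra (integralClosure R E) (integralClosure R L) := ι.toAlgebra
    haveI : IsGaloisGroup π.ker (integralClosure R E) (integralClosure R L) :=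
      isGaloisGroup_ker π ι hequiv hfix
    haveI hRTS : IsScalarTower R (integralClosure R E) (integralClosure R L) :=
      IsScalarTower.of_algebraMap_eq fun r => ((E.integralClosureInclusion R).commutes r).symm
    haveI : Module.Finite (integralClosure R E) (integralClosure R L) :=
      Module.Finite.of_restrictScalars_finite R _ _
    haveI : FaithfulSMul (integralClosure R E) (integralClosure R L) :=
      (faithfulSMul_iff_algebraMap_injective _ _).mpr hι
    haveI : Algebra.IsIntegral (integralClosure R E) (integralClosure R L) :=
      Algebra.IsInvariant.isIntegral _ _ π.ker
    haveI h𝔮max : (𝔓.under (integralClosure R E)).IsMaximal := Ideal.IsMaximal.under _ 𝔓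
    haveI h𝔭max : (𝔓.under R).IsMaximal := Ideal.IsMaximal.under R 𝔓
    -- the residue extension of `𝔓` over `𝔓 ∩ E` is separable (tower over `𝔓 ∩ R`)
    haveI hover₁ : 𝔓.LiesOver (𝔓.under (integralClosure R E)) := ⟨rfl⟩
    haveI hover₂ : (𝔓.under (integralClosure R E)).LiesOver (𝔓.under R) :=
      ⟨(Ideal.under_under 𝔓).symm⟩
    letI : Field (integralClosure R E ⧸ 𝔓.under (integralClosure R E)) := Ideal.Quotient.field _
    letI algq : Algebra (integralClosure R E ⧸ 𝔓.under (integralClosure R E))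
        (integralClosure R L ⧸ 𝔓) := Ideal.Quotient.algebraOfLiesOver _ _
    haveI : IsScalarTower (R ⧸ 𝔓.under R)
        (integralClosure R E ⧸ 𝔓.under (integralClosure R E)) (integralClosure R L ⧸ 𝔓) :=
      IsScalarTower.of_algebraMap_eq fun r => by
        obtain ⟨r, rfl⟩ := Ideal.Quotient.mk_surjective (I := 𝔓.under R) r
        rw [Ideal.Quotient.algebraMap_mk_of_liesOver, Ideal.Quotient.algebraMap_mk_of_liesOver,
          Ideal.Quotient.algebraMap_mk_of_liesOver, IsScalarTower.algebraMap_apply R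
            (integralClosure R E) (integralClosure R L)]
    haveI : Algebra.IsSeparable (integralClosure R E ⧸ 𝔓.under (integralClosure R E))
        (integralClosure R L ⧸ 𝔓) :=
      Algebra.isSeparable_tower_top_of_isSeparable (R ⧸ 𝔓.under R)
        (integralClosure R E ⧸ 𝔓.under (integralClosure R E)) (integralClosure R L ⧸ 𝔓)
    exact emultiplicity_map_under_eq_card_inertia_of_isSeparable π.ker 𝔓 h𝔓
  -- Prop. IV.3 for these data (`IndexFormula`), then Herbrand's theorem
  have h3 : IndexFormula 𝔓 (𝔓.comap (E.integralClosureInclusion R))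
      (AlgEquiv.restrictNormalHom E : (L ≃ₐ[K] L) →* (E ≃ₐ[K] E)) :=
    indexFormula_of_galoisQuotientData 𝔓 π ι hι hequiv hfix R hsep hcard
  exact upperRamificationSubgroup_eq_map_restrictNormalHom_of_indexFormula R E 𝔓 h3 v

end HerbrandQuotientHolds

/-! ### Consequences: `Γ_K^u ↠ Gal(E/K)^u` and the conductor formula -/

section Consequences

universe u v w

variable {K : Type u} [Field K] {A : Type v} [Field A] [TopologicalSpace A]
  {M : Type w} [AddCommGroup M] [Module A M] [TopologicalSpace M]

/-- **Discharge of `Literature.NumberTheory.GaloisRepresentations.absUpperRamificationSubgroup_map_absRestrictNormalHom`**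
(`ArtinConductorIntegrality.lean`): `Γ_K^u|_E = Gal(E/K)^u` at every prime of a number field, from
Herbrand's theorem at the finite layers (`herbrand_quotient_holds`) by
`absUpperRamificationSubgroup_map_absRestrictNormalHom_of` (compactness of `Γ_K`, Serre IV §3
Remark 1).  Ref: Serre, *Local Fields*, Ch. IV §3, Prop. 14 and Remark 1.
[cite: SerreLocalFields1979, Ch. IV §3 Prop. 14 and Remark 1] -/
theorem absUpperRamificationSubgroup_map_absRestrictNormalHom_holds :
    absUpperRamificationSubgroup_map_absRestrictNormalHom (K := K) :=
  absUpperRamificationSubgroup_map_absRestrictNormalHom_of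
    fun R _ _ _ _ hle => herbrand_quotient_holds R (IntermediateField.restrict hle)

/-- **Discharge of `Literature.NumberTheory.GaloisRepresentations.GaloisRep.artinConductorAt_eq_finsum_ramificationSubgroup`** (the
lower-numbering conductor formula, Serre VI §2 Cor. 1'): for a number field `K`, a prime `𝔓 ∣ v`
of `\bar ℤ_K` and `ρ` factoring through `Gal(E/K)`, `a_𝔓(ρ) = Σ_{i ≥ 0} (g_i/g_0) codim M^{G_i}`;
by `artinConductorAt_eq_finsum_ramificationSubgroup_of_herbrand_quotient`
(`ArtinConductorIntegralityProofs.lean`) and `herbrand_quotient_holds`.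
Ref: Serre, *Local Fields*, Ch. VI §2, Cor. 1' to Prop. 2; Ch. IV §3, Prop. 14.
[cite: SerreLocalFields1979, Ch. VI §2, Cor. 1'] -/
theorem GaloisRep.artinConductorAt_eq_finsum_ramificationSubgroup_holds [FiniteDimensional A M] :
    GaloisRep.artinConductorAt_eq_finsum_ramificationSubgroup (K := K) (A := A) (M := M) :=
  GaloisRep.artinConductorAt_eq_finsum_ramificationSubgroup_of_herbrand_quotient
    fun R _ _ _ _ hle => herbrand_quotient_holds R (IntermediateField.restrict hle)

/-- **Discharge of `Literature.NumberTheory.GaloisRepresentations.GaloisRep.artinConductorAt_eq_artinExponent_inertia`**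
(`ArtinConductorIntegrality.lean`: `a_𝔓(ρ) = f(ρ|_{I_𝔓})`, Katz's Prop. 1.9 reduction), by
`artinConductorAt_eq_artinExponent_inertia_of_herbrand_quotient` and `herbrand_quotient_holds`.
[cite: Katz1988, Ch. 1, Prop. 1.9 (proof)] [cite: SerreLocalFields1979, Ch. IV §3 Prop. 14] -/
theorem GaloisRep.artinConductorAt_eq_artinExponent_inertia_holds [FiniteDimensional A M] :
    GaloisRep.artinConductorAt_eq_artinExponent_inertia (K := K) (A := A) (M := M) :=
  GaloisRep.artinConductorAt_eq_artinExponent_inertia_of_herbrand_quotient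
    fun R _ _ _ _ hle => herbrand_quotient_holds R (IntermediateField.restrict hle)

end Consequences

end Literature.NumberTheory.GaloisRepresentations
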